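import Summits.NavierStokesRegularity.NavierStokesRegularity.Theorems.RootDecompLiouvilleHorizonKills
import HarnessLib

/-!
# Route `RootDecompLiouvilleHorizon` (N22): FR `LateRecordsExist` (item stmt-NavierStokesRegularity-32063) — closing link

The proof is `Theorems.RootDecompLiouvilleHorizonKills.lateRecordsExist_proof` (landed with K2's workitem;
one proposal carries one `--workitem`); this file is the by-name closing link for FR's item.
-/

set_option linter.dupNamespace false

namespace Summit.NavierStokesRegularity.NavierStokesRegularity.Theorems.RootDecompLiouvilleHorizonLateRecords

/-- **FR `LateRecordsExist`, item stmt-NavierStokesRegularity-32063**: near-record fast points of a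
maximal smooth Leray–Hopf blow-up occur at times arbitrarily close to `T`
(`RootDecompLiouvilleHorizonKills.lateRecordsExist_proof`, KNSS 2009 §6 selection). [cite: KochNadirashviliSereginSverak2009, §6 (arXiv p. 11)] -/
theorem lateRecordsExist_holds :
    Summit.NavierStokesRegularity.NavierStokesRegularity.Theses.RootDecompLiouvilleHorizon.LateRecordsExist :=
  RootDecompLiouvilleHorizonKills.lateRecordsExist_proof

end Summit.NavierStokesRegularity.NavierStokesRegularity.Theorems.RootDecompLiouvilleHorizonLateRecords
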